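import Summits.BirchSwinnertonDyer.Rank1Residual.Additive.DefectCountSignedSelmerReceptacle
import Summits.BirchSwinnertonDyer.Rank1Residual.Additive.LevelToLayerZero
import HarnessLib

/-!
# THE COUNT (C) FROM B3 IN LEVEL-`m` SHAPE AT `v₀`: **`[A₀ : S₀] = p^ν · ∏_{ℓ ∈ T} [𝓣_ℓ : 𝓚_ℓ]`**
# — the receptacle `G = p^{ν+e}·Σ_m` of a cyclic minus line `Σ_m` (x1b GEN 39 note §3 (iv) made
# kernel; cell `b2b-bsdres`, CLASS-CLOSURE lane, class O10 — x1b GEN 41, class lead; file 100 of the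
# series)

HONEST FRAMING (cell `b2b-bsdres`, run/shared/lean/b2b/bsd-rank1-residual/, verbatim in every
file): the goal of the cell is to DELETE the COMBINATION-SHAPED residual classes of the
Birch–Swinnerton-Dyer formula for ALL analytic-rank `≤ 1` elliptic curves over `ℚ` — "full BSD
formula for every rank `≤ 1` curve in class `C`" assembled STRICTLY from published theorems — so
that the rank-`≤ 1` remainder becomes exactly the CONSTRUCTION-SHAPED classes, which are TYPED
(missing-input `Prop`s), NOT attempted. This is not "finishing BSD". CLASS-CLOSURE lane: prove
what is provable now; shrink each hard class to its core with data; no claim beyond stated classes;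
research routes on CONSTRUCTION-SHAPED X12 / O10; census / instrument output = EVIDENCE / conjecture
items, NEVER a Literature fact; `RESIDUAL-MAP.md` marks change only by signed lines. THIS FILE:
TOOL THEOREMS ONLY — no definition, no named Literature fact, no Summits-side fact `def … : Prop`,
no `sorry`, axioms standard; CONDITIONAL (hypotheses) on a Poitou–Tate family injective at the real
places (the property list of the tree's named fact `poitouTate_selmerStructure_duality_real`), on
Tate's local Euler characteristic (named fact `localEulerPoincareCharacteristic`), on the level-`m`
minus line at `v₀` (B3 in level-`m` shape, stated at the completion `K_{v₀}`) and on the rank-one /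
`Ш` / local-point inputs; nothing is booked; no label / mark / count / sub-cell moves; (C1_η),
(C2_η-GZ), (C3_η) stay typed as filed (cc-typer-6's pen); O10 stays OPEN / CONSTRUCTION-SHAPED;
nothing about `BSD(W, p)` of any pair is claimed.

## What (x1b GEN 39 note §3 (iv), the re-assembly recipe)

* §1 (finite cyclic groups): in a subgroup `C` of order `p^m` containing an element of order `p^m`,
  a subgroup `L ≤ C` with `#L ≤ p^{m−k}` lies in `p^k·C` (`le_map_nsmul_of_card_le`), and
  `#(p^k·C) = p^{m−k}` (`natCard_map_nsmul_eq_pow_sub`).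
* §2 **`relIndex_strictSignedSelmerLayer_localPreimage_eq_of_minusLine`**: given at `v₀` a subgroup
  `C ≤ H¹(K_{v₀}, E[p^m])` with `C ≤ 𝓣_{v₀}` (tower condition), `#C = p^m`, an element of order
  `p^m`, `C ⊔ 𝓚_{v₀} = ⊤` (B3 IN LEVEL-`m` SHAPE — for the `p*`-twist at the model `ℚ_[p]` this is
  x1b files 91–98, `SignedTwist.closure_minus_sup_range_localKummerMap_eq_top_of_localEuler`, modulo
  the named fact `localEulerPoincareCharacteristic ℚ_[p]`), `loc_{v₀}(Ψ_m⁻¹A₀) ⊆ C` (file 86 at the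
  model) and "`loc_{v₀} c ∈ C`, `Ψ_m c ∈ h_0⁻¹(Sel_∞)` ⟹ `Ψ_m c` signed" (file 85 at the model),
  `#A₀ ∣ p^a` with `a + ν + e ≤ m`, `2ν + e ≤ m`: file 99 with the receptacle `G = p^{ν+e}·C`
  (`𝓣_{v₀} ⊓ G = G`; (a) `L ≤ G` by §1 since `#L ≤ #A₀` by the injectivity of `Ψ_m`, file 71;
  (b) from detection on `C ⊇ G`), `t = ν + e`, `#(p^t·C) = p^{m−t}`; dividing by `p^{m−t−ν}`:
  **`[A₀ : S₀] = p^ν · ∏_{ℓ ∈ T} [𝓣_ℓ : 𝓚_ℓ]`** (`= p^ν · Tam(W)^{(p)}` with file 75) — the count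
  (C) of the (C3_η) derivation MODULO the named facts, the rank-one inputs, and the supply of the
  minus line AT THE COMPLETION `ℚ_{v₀}` (x1b's B3 lives at `ℚ_[p]`; the model transport
  `ℚ_[p] ⇄ ℚ_{v₀}` of the line is the one remaining plumbing item, GEN 41 note §3).

References: [GreenbergLNM1716] §3–§4; [Kobayashi2003] Def. 2.1, Thm. 6.2, §9; [MilneADT2006] I §2–§6.
-/

noncomputable section

open scoped Classical

open CategoryTheory Field Function NumberField IsDedekindDomain WeierstrassCurve
open Literature.NumberTheory.EllipticCurves
open Literature.NumberTheory.GaloisRepresentations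
open Literature.NumberTheory.GaloisRepresentations.DiscreteGaloisModule (SelmerStructure)
open Literature.NumberTheory.GaloisCohomology
open Literature.NumberTheory.EllipticCurves.Kobayashi2003
open Summit.BirchSwinnertonDyer.Rank1Residual.X11b.Levels
open Summit.BirchSwinnertonDyer.Rank1Residual.X11b
open Summit.BirchSwinnertonDyer.Rank1Residual.Additive.DefectCountFiniteLevel
open scoped ContRepresentation

namespace Summit.BirchSwinnertonDyer.Rank1Residual.Additive.LevelBridge

variable {K : Type} [Field K] [NumberField K] (W : WeierstrassCurve K) [W.IsElliptic]

/-! ## §1 Finite cyclic groups of order `p^m` -/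

section Cyclic

variable {A : Type*} [AddCommGroup A] {p : ℕ} [hp : Fact p.Prime] {m k : ℕ} {C L : AddSubgroup A} {s : A}

/-- A subgroup of order `p^m` containing an element of order `p^m` is generated by it. [folklore] -/
theorem eq_zmultiples_of_card_eq (hsC : s ∈ C) (hs : addOrderOf s = p ^ m) (hC : Nat.card C = p ^ m) :
    C = AddSubgroup.zmultiples s := by
  haveI : Finite C := Nat.finite_of_card_ne_zero (by rw [hC]; exact pow_ne_zero m hp.out.ne_zero)
  refine (AddSubgroup.eq_of_le_of_card_ge (AddSubgroup.zmultiples_le_of_mem hsC) ?_).symm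
  rw [Nat.card_zmultiples, hs, hC]

/-- **In a cyclic group `C` of order `p^m`, a subgroup `L` with `#L ≤ p^{m−k}` lies in `p^k·C`.**
[folklore] -/
theorem le_map_nsmul_of_card_le (hk : k ≤ m) (hsC : s ∈ C) (hs : addOrderOf s = p ^ m)
    (hC : Nat.card C = p ^ m) (hLC : L ≤ C) (hL : Nat.card L ≤ p ^ (m - k)) (hLfin : Finite L) :
    L ≤ C.map (nsmulAddMonoidHom (p ^ k)) := by
  have hCz := eq_zmultiples_of_card_eq hsC hs hC
  intro x hx
  -- `addOrderOf x = p^j` with `p^j ∣ #L ≤ p^{m−k}`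
  have hxC : x ∈ C := hLC hx
  have hordC : addOrderOf x ∣ p ^ m := by
    have h := addOrderOf_dvd_natCard (⟨x, hxC⟩ : C)
    rw [← AddSubgroup.addOrderOf_coe, hC] at h
    exact h
  obtain ⟨j, hj, hjx⟩ := (Nat.dvd_prime_pow hp.out).mp hordC
  have hordL : addOrderOf x ∣ Nat.card L := by
    have h := addOrderOf_dvd_natCard (⟨x, hx⟩ : L)
    rw [← AddSubgroup.addOrderOf_coe] at h
    exact h
  have hLpos : 0 < Nat.card L := Nat.card_pos
  have hjle : j ≤ m - k := by
    have h1 : p ^ j ≤ p ^ (m - k) := (hjx ▸ Nat.le_of_dvd hLpos hordL).trans hL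
    exact (Nat.pow_le_pow_iff_right hp.out.one_lt).mp h1
  have hkill : p ^ (m - k) • x = 0 := by
    apply addOrderOf_dvd_iff_nsmul_eq_zero.mp
    rw [hjx]; exact pow_dvd_pow p hjle
  -- `x = a • s`, and `p^m ∣ p^{m−k} a` forces `p^k ∣ a`
  rw [hCz, AddSubgroup.mem_zmultiples_iff] at hxC
  obtain ⟨a, rfl⟩ := hxC
  have hdvd : ((p ^ m : ℕ) : ℤ) ∣ (p ^ (m - k) : ℕ) * a := by
    rw [← hs, addOrderOf_dvd_iff_zsmul_eq_zero, mul_zsmul, natCast_zsmul, hkill]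
  have hsplit : ((p ^ m : ℕ) : ℤ) = (p ^ (m - k) : ℕ) * (p ^ k : ℕ) := by
    rw [← Nat.cast_mul, ← pow_add, Nat.sub_add_cancel hk]
  rw [hsplit] at hdvd
  obtain ⟨b, hb⟩ := (mul_dvd_mul_iff_left (by exact_mod_cast pow_ne_zero (m - k) hp.out.ne_zero)).mp hdvd
  refine AddSubgroup.mem_map.mpr ⟨b • s, ?_, ?_⟩
  · rw [hCz]; exact AddSubgroup.zsmul_mem _ (AddSubgroup.mem_zmultiples s) b
  · rw [nsmulAddMonoidHom_apply, hb, mul_zsmul, natCast_zsmul]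

/-- **`#(p^k·C) = p^{m−k}`** for a cyclic `C` of order `p^m`, `k ≤ m`. [folklore] -/
theorem natCard_map_nsmul_eq_pow_sub (hk : k ≤ m) (hsC : s ∈ C) (hs : addOrderOf s = p ^ m)
    (hC : Nat.card C = p ^ m) : Nat.card (C.map (nsmulAddMonoidHom (p ^ k))) = p ^ (m - k) := by
  rw [eq_zmultiples_of_card_eq hsC hs hC, AddMonoidHom.map_zmultiples, Nat.card_zmultiples,
    nsmulAddMonoidHom_apply, addOrderOf_nsmul_of_dvd (pow_ne_zero k hp.out.ne_zero)
      (by rw [hs]; exact pow_dvd_pow p hk), hs, Nat.pow_div hk hp.out.pos]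

end Cyclic

/-! ## §2 The count from the minus line at `v₀` -/

/-- **THE COUNT (C) FROM B3 IN LEVEL-`m` SHAPE AT `v₀`: `[A₀ : S₀] = p^ν · ∏_{ℓ ∈ T} [𝓣_ℓ : 𝓚_ℓ]`.**
Given at the completion `K_{v₀}` a subgroup `C ≤ H¹(K_{v₀}, E[p^m])` inside the tower condition
`𝓣_{v₀}`, of order `p^m` with an element of order `p^m`, complementary to the Kummer group
(`C ⊔ 𝓚_{v₀} = ⊤`), containing `loc_{v₀} c` whenever `Ψ_m c ∈ A₀` and detecting the signed condition
(`Ψ_m c ∈ h_0⁻¹(Sel_∞)`, `loc_{v₀} c ∈ C ⟹ Ψ_m c` signed), with `#A₀ ∣ p^a`, `a + ν + e ≤ m`,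
`2ν + e ≤ m`, and file 99's other hypotheses (Poitou–Tate family, local Euler characteristic,
`#(𝓞_{v₀}/p^m) = p^m`, the model `E`, the tower structure, (MW), (Ш), (Γ), (loc), (kill)): file 99
with the receptacle `G = p^{ν+e}·C` (`L ≤ G` by §1 and the injectivity of `Ψ_m`; `#(p^{ν+e}·C) =
p^{m−ν−e}`), divided by `p^{m−2ν−e}`.  CONDITIONAL on the listed hypotheses; nothing booked.
[cite: GreenbergLNM1716, §4 (pp. 98–103)] [cite: Kobayashi2003, Def. 2.1 (p. 5), Thm. 6.2 (p. 11), Thm. 9.3 (p. 26)]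
[cite: MilneADT2006, Ch. I, Thm. 2.8, Lemma 3.3 and Thm. 4.10] -/
theorem relIndex_strictSignedSelmerLayer_localPreimage_eq_of_minusLine {p m : ℕ} [hp : Fact p.Prime]
    (κ : ZpExtension K p) (hm : 1 ≤ m)
    (inv : LocalInvariants K (p ^ m)) (hperf : inv.IsPerfect) (hvan : inv.SumLocalTermEqZero)
    (hcomp : inv.SelmerComplement)
    (hreal : ∀ w : InfinitePlace K, w.IsReal → Injective (inv (Sum.inl w)))
    (hEP : ∀ v : HeightOneSpectrum (𝓞 K), localEulerPoincareCharacteristic (v.adicCompletion K))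
    (w₀ : HeightOneSpectrum (𝓞 K))
    (hOv : Nat.card (w₀.adicCompletionIntegers K ⧸
      Ideal.span {((p ^ m : ℕ) : w₀.adicCompletionIntegers K)}) = p ^ m)
    -- the model `E` of `K_{v₀}`
    (E : Type) [Field E] [Algebra K E] [Algebra (w₀.adicCompletion K) E]
    [IsScalarTower K (w₀.adicCompletion K) E] [Algebra E (w₀.adicCompletion K)]
    [IsScalarTower K E (w₀.adicCompletion K)]
    (hΓE : ∀ Q : W.geomPrimaryTorsion p, (∀ σ : absoluteGaloisGroup E,
      GaloisRep.restrictField E (LocBridge.primaryGaloisModule W p) σ Q = Q) → Q = 0)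
    -- the tower structure and the exceptional set
    (T : Finset (HeightOneSpectrum (𝓞 K))) (hw₀T : w₀ ∉ T)
    (𝓣 : SelmerStructure (W.torsionGaloisModule ((p ^ m : ℕ) : ℤ)))
    (h𝓣fin : ∀ v : HeightOneSpectrum (𝓞 K), 𝓣 (Sum.inr v) =
      (W.localTowerKer κ (v.adicCompletion K) 0).comap
        ((resH1Hom (Literature.NumberTheory.EllipticCurves.subgroupIncl (localSubgroup (κ.layerSubgroup 0) (v.adicCompletion K)))
          (AddMonoidHom.id (localPoints W (v.adicCompletion K))) (fun _ _ ↦ rfl)).comp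
          (galoisCohomology.map
            (W.torsionPointsMapIntertwining ((p ^ m : ℕ) : ℤ) (v.adicCompletion K)) 1)))
    (h𝓣inf : ∀ w : InfinitePlace K, 𝓣 (Sum.inl w) = W.kummerSelmerStructure ((p ^ m : ℕ) : ℤ) (Sum.inl w))
    (hT0 : ∀ v : HeightOneSpectrum (𝓞 K), v ∉ T → v ≠ w₀ →
      W.localTowerKerPrimary κ (v.adicCompletion K) 0 = ⊥)
    -- B3 in level-`m` shape at `v₀`: the minus line `C` (cyclic of order `p^m`, inside the tower
    -- condition, complementary to the Kummer group, containing the localisations of `Ψ_m⁻¹A₀`,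
    -- detecting the signed condition) and the size of `A₀`
    (C : AddSubgroup (galoisCohomology
      ((W.torsionGaloisModule ((p ^ m : ℕ) : ℤ)).toLocal (Sum.inr w₀)) 1))
    {ν eSha a : ℕ}
    (hCT : C ≤ 𝓣 (Sum.inr w₀)) (hCcard : Nat.card C = p ^ m) (hCcyc : ∃ s ∈ C, addOrderOf s = p ^ m)
    (hLC : ∀ c : galoisCohomology (W.torsionGaloisModule ((p ^ m : ℕ) : ℤ)) 1,
      resH1Hom (Literature.NumberTheory.EllipticCurves.subgroupIncl (κ.layerSubgroup 0))
        (AddMonoidHom.id (geomPrimaryTorsion W p))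
        (fun _ _ ↦ rfl) (galoisCohomology.map (primaryInclusion W p m) 1 c) ∈
        (W.selmerInfty κ ⊓ ⨅ σ : absoluteGaloisGroup K,
            (localKummerOverOfEmb W p κ.kerSubgroup (closureEmb (K := K) E)
              (⨆ n, strictSignedLocalPoints κ E W (-1) n)).comap
              (W.conjH1 p κ.kerSubgroup σ)).comap (W.layerToInfty κ 0) →
      galoisCohomology.localization (W.torsionGaloisModule ((p ^ m : ℕ) : ℤ)) (Sum.inr w₀) 1 c ∈ C)
    (hCdet : ∀ c : galoisCohomology (W.torsionGaloisModule ((p ^ m : ℕ) : ℤ)) 1,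
      resH1Hom (Literature.NumberTheory.EllipticCurves.subgroupIncl (κ.layerSubgroup 0))
        (AddMonoidHom.id (geomPrimaryTorsion W p))
        (fun _ _ ↦ rfl) (galoisCohomology.map (primaryInclusion W p m) 1 c) ∈ W.selmerInftyPreimage κ 0 →
      galoisCohomology.localization (W.torsionGaloisModule ((p ^ m : ℕ) : ℤ)) (Sum.inr w₀) 1 c ∈ C →
      resH1Hom (Literature.NumberTheory.EllipticCurves.subgroupIncl (κ.layerSubgroup 0))
        (AddMonoidHom.id (geomPrimaryTorsion W p))
        (fun _ _ ↦ rfl) (galoisCohomology.map (primaryInclusion W p m) 1 c) ∈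
        (⨅ σ : absoluteGaloisGroup K,
            (localKummerOverOfEmb W p κ.kerSubgroup (closureEmb (K := K) E)
              (⨆ n, strictSignedLocalPoints κ E W (-1) n)).comap
              (W.conjH1 p κ.kerSubgroup σ)).comap (W.layerToInfty κ 0))
    (hA₀card : Nat.card ↥((W.selmerInfty κ ⊓ ⨅ σ : absoluteGaloisGroup K,
        (localKummerOverOfEmb W p κ.kerSubgroup (closureEmb (K := K) E)
          (⨆ n, strictSignedLocalPoints κ E W (-1) n)).comap
            (W.conjH1 p κ.kerSubgroup σ)).comap (W.layerToInfty κ 0)) ∣ p ^ a)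
    -- (MW)
    (hdiv : W.zsmul_geomPoints_surjective) (P : W.toAffine.Point)
    (hgen : ∀ Q : W.toAffine.Point, ∃ a : ℤ,
      Q - a • P ∈ (zsmulAddGroupHom ((p ^ m : ℕ) : ℤ) : W.toAffine.Point →+ _).range)
    (hord : ∀ a : ℤ, a • P ∈ (zsmulAddGroupHom ((p ^ m : ℕ) : ℤ) : W.toAffine.Point →+ _).range →
      ((p ^ m : ℕ) : ℤ) ∣ a)
    -- (Ш)
    (hSha : ∀ c ∈ W.sha, ((p ^ m : ℕ) : ℤ) • c = 0 → p ^ eSha • c = 0)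
    -- (Γ)
    (hΓ : ∀ Q : W.geomPrimaryTorsion p,
      (∀ σ : absoluteGaloisGroup K, X11b.LocBridge.primaryGaloisModule W p σ Q = Q) → Q = 0)
    -- (loc) at `v₀`
    [CharZero (Place.Completion (Sum.inr w₀ : Place K))]
    (htors : ∀ X : (W.baseChange (Place.Completion (Sum.inr w₀ : Place K))).toAffine.Point,
      p • X = 0 → X = 0)
    {Qv : (W.baseChange (Place.Completion (Sum.inr w₀ : Place K))).toAffine.Point}
    (hPQ : p ^ ν • Qv = Affine.Point.baseChange (W' := W) K (Place.Completion (Sum.inr w₀ : Place K)) P)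
    (hexact : ∀ Q' : (W.baseChange (Place.Completion (Sum.inr w₀ : Place K))).toAffine.Point,
      p ^ (ν + 1) • Q' ≠ Affine.Point.baseChange (W' := W) K (Place.Completion (Sum.inr w₀ : Place K)) P)
    -- (span) at `v₀`
    (hCL : C ⊔ W.kummerSelmerStructure ((p ^ m : ℕ) : ℤ) (Sum.inr w₀) = ⊤)
    -- (kill) at `ℓ ∈ T`
    (hkill : ∀ w ∈ T, ∀ x ∈ W.kummerSelmerStructure ((p ^ m : ℕ) : ℤ) (Sum.inr w),
      p ^ (m - (ν + eSha) - ν) • x = 0)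
    (hnum : a + ν + eSha ≤ m) (hm2 : 2 * ν + eSha ≤ m) :
    (strictSignedSelmerLayer W κ E (-1) 0).relIndex
        ((W.selmerInfty κ ⊓ ⨅ σ : absoluteGaloisGroup K,
          (localKummerOverOfEmb W p κ.kerSubgroup (closureEmb (K := K) E)
            (⨆ n, strictSignedLocalPoints κ E W (-1) n)).comap
              (W.conjH1 p κ.kerSubgroup σ)).comap (W.layerToInfty κ 0)) =
      p ^ ν * ∏ w ∈ T, (W.kummerSelmerStructure ((p ^ m : ℕ) : ℤ) (Sum.inr w)).relIndex (𝓣 (Sum.inr w)) := by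
  -- abbreviation for `A₀`
  set A₀ := ((W.selmerInfty κ ⊓ ⨅ σ : absoluteGaloisGroup K,
          (localKummerOverOfEmb W p κ.kerSubgroup (closureEmb (K := K) E)
            (⨆ n, strictSignedLocalPoints κ E W (-1) n)).comap
              (W.conjH1 p κ.kerSubgroup σ)).comap (W.layerToInfty κ 0)) with hA₀def
  have hpa : 0 < p ^ a := pow_pos hp.out.pos a
  haveI hA₀fin : Finite A₀ := Nat.finite_of_card_ne_zero fun h ↦ by
    rw [h] at hA₀card; exact (Nat.pos_iff_ne_zero.mp hpa) (zero_dvd_iff.mp hA₀card)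
  -- `p^m A₀ = 0`
  have hA₀ : ∀ z ∈ A₀, p ^ m • z = 0 := fun z hz ↦ by
    have h1 : addOrderOf (⟨z, hz⟩ : A₀) ∣ p ^ m :=
      ((addOrderOf_dvd_natCard (⟨z, hz⟩ : A₀)).trans hA₀card).trans
        (pow_dvd_pow p (by omega))
    exact congrArg Subtype.val (addOrderOf_dvd_iff_nsmul_eq_zero.mp h1)
  -- the receptacle `G = p^(ν+e)·C`, with `𝓣_(v₀) ⊓ G = G`
  have hGle : C.map (nsmulAddMonoidHom (p ^ (ν + eSha))) ≤ C := fun x hx ↦ by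
    obtain ⟨y, hy, rfl⟩ := AddSubgroup.mem_map.mp hx
    exact C.nsmul_mem hy _
  have hC : 𝓣 (Sum.inr w₀) ⊓ C.map (nsmulAddMonoidHom (p ^ (ν + eSha))) =
      C.map (nsmulAddMonoidHom (p ^ (ν + eSha))) :=
    inf_eq_right.mpr (hGle.trans hCT)
  -- (a) `hLG`: `L ≤ p^t·C` from `#L ≤ #A₀ ≤ p^a ≤ p^(m−t)` inside the cyclic `C`
  obtain ⟨s, hsC, hs⟩ := hCcyc
  haveI : Finite C :=
    Nat.finite_of_card_ne_zero (by rw [hCcard]; exact pow_ne_zero m hp.out.ne_zero)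
  -- the map `Ψ_m` as a homomorphism and its injectivity (file 71)
  set Ψh : galoisCohomology (W.torsionGaloisModule ((p ^ m : ℕ) : ℤ)) 1 →+
      W.subgroupH1 p (κ.layerSubgroup 0) :=
    (resH1Hom (Literature.NumberTheory.EllipticCurves.subgroupIncl (κ.layerSubgroup 0))
      (AddMonoidHom.id (geomPrimaryTorsion W p)) (fun _ _ ↦ rfl)).comp
      (galoisCohomology.map (primaryInclusion W p m) 1) with hΨh
  have hΨh_apply : ∀ c, Ψh c = resH1Hom (Literature.NumberTheory.EllipticCurves.subgroupIncl (κ.layerSubgroup 0))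
        (AddMonoidHom.id (geomPrimaryTorsion W p))
        (fun _ _ ↦ rfl) (galoisCohomology.map (primaryInclusion W p m) 1 c) := fun c ↦ rfl
  have hΨinj : Function.Injective Ψh := by
    intro c₁ c₂ h
    apply levelToLayerZero_injective W p κ m hΓ
    beta_reduce
    rw [← hΨh_apply c₁, ← hΨh_apply c₂]
    exact h
  -- the subgroup `L = loc(Ψ⁻¹ A₀)` and its order
  set L := (A₀.comap Ψh).map
    (galoisCohomology.localization (W.torsionGaloisModule ((p ^ m : ℕ) : ℤ)) (Sum.inr w₀) 1) with hL
  have hLC' : L ≤ C := by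
    rintro x ⟨c, hc, rfl⟩
    have hc' : Ψh c ∈ A₀ := AddSubgroup.mem_comap.mp hc
    rw [hΨh_apply] at hc'
    exact hLC c hc'
  have hinjA : Function.Injective (fun c : A₀.comap Ψh ↦ (⟨Ψh c.1, c.2⟩ : A₀)) := by
    intro c c' h
    apply Subtype.ext
    apply hΨinj
    have h' := congrArg Subtype.val h
    simpa using h'
  haveI : Finite (A₀.comap Ψh) := Finite.of_injective _ hinjA
  have hLcard : Nat.card L ≤ p ^ (m - (ν + eSha)) := by
    calc Nat.card L ≤ Nat.card (A₀.comap Ψh) :=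
          Nat.card_le_card_of_surjective (fun c : A₀.comap Ψh ↦
            (⟨galoisCohomology.localization (W.torsionGaloisModule ((p ^ m : ℕ) : ℤ)) (Sum.inr w₀) 1 c.1,
              AddSubgroup.mem_map_of_mem _ c.2⟩ : L)) fun x ↦ by
              obtain ⟨c, hc, hcx⟩ := AddSubgroup.mem_map.mp x.2
              exact ⟨⟨c, hc⟩, Subtype.ext hcx⟩
      _ ≤ Nat.card A₀ := Nat.card_le_card_of_injective _ hinjA
      _ ≤ p ^ a := Nat.le_of_dvd hpa hA₀card
      _ ≤ p ^ (m - (ν + eSha)) := Nat.pow_le_pow_right hp.out.pos (by omega)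
  have hLfin : Finite L := Finite.of_injective (fun x : L ↦ (⟨x.1, hLC' x.2⟩ : C))
    fun x y h ↦ by
      apply Subtype.ext
      have h' := congrArg Subtype.val h
      simpa using h'
  have key := le_map_nsmul_of_card_le (by omega : ν + eSha ≤ m) hsC hs hCcard hLC' hLcard hLfin
  have hLG : ∀ c : galoisCohomology (W.torsionGaloisModule ((p ^ m : ℕ) : ℤ)) 1,
      resH1Hom (Literature.NumberTheory.EllipticCurves.subgroupIncl (κ.layerSubgroup 0))
        (AddMonoidHom.id (geomPrimaryTorsion W p))
        (fun _ _ ↦ rfl) (galoisCohomology.map (primaryInclusion W p m) 1 c) ∈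
        ((W.selmerInfty κ ⊓ ⨅ σ : absoluteGaloisGroup K,
          (localKummerOverOfEmb W p κ.kerSubgroup (closureEmb (K := K) E)
            (⨆ n, strictSignedLocalPoints κ E W (-1) n)).comap
              (W.conjH1 p κ.kerSubgroup σ)).comap (W.layerToInfty κ 0)) →
      galoisCohomology.localization (W.torsionGaloisModule ((p ^ m : ℕ) : ℤ)) (Sum.inr w₀) 1 c ∈
        C.map (nsmulAddMonoidHom (p ^ (ν + eSha))) := by
    intro c hc
    have hc' : c ∈ A₀.comap Ψh := by
      rw [AddSubgroup.mem_comap, hΨh_apply]; exact hc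
    exact key (AddSubgroup.mem_map_of_mem _ hc')
  -- (b) `hG`: detection, since `p^t·C ≤ C`
  have hG : ∀ c : galoisCohomology (W.torsionGaloisModule ((p ^ m : ℕ) : ℤ)) 1,
      resH1Hom (Literature.NumberTheory.EllipticCurves.subgroupIncl (κ.layerSubgroup 0))
        (AddMonoidHom.id (geomPrimaryTorsion W p))
        (fun _ _ ↦ rfl) (galoisCohomology.map (primaryInclusion W p m) 1 c) ∈ W.selmerInftyPreimage κ 0 →
      galoisCohomology.localization (W.torsionGaloisModule ((p ^ m : ℕ) : ℤ)) (Sum.inr w₀) 1 c ∈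
        C.map (nsmulAddMonoidHom (p ^ (ν + eSha))) →
      resH1Hom (Literature.NumberTheory.EllipticCurves.subgroupIncl (κ.layerSubgroup 0))
        (AddMonoidHom.id (geomPrimaryTorsion W p))
        (fun _ _ ↦ rfl) (galoisCohomology.map (primaryInclusion W p m) 1 c) ∈
        (⨅ σ : absoluteGaloisGroup K,
            (localKummerOverOfEmb W p κ.kerSubgroup (closureEmb (K := K) E)
              (⨆ n, strictSignedLocalPoints κ E W (-1) n)).comap
              (W.conjH1 p κ.kerSubgroup σ)).comap (W.layerToInfty κ 0) :=
    fun c hc hloc ↦ hCdet c hc (hGle hloc)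
  -- file 99 with `G = p^t·C`, `t = ν + e`
  have h99 := relIndex_strictSignedSelmerLayer_localPreimage_mul_prime_pow_eq_of_receptacle W κ hm inv
    hperf hvan hcomp hreal hEP w₀ hOv E hΓE T hw₀T 𝓣 h𝓣fin h𝓣inf hT0
    (C.map (nsmulAddMonoidHom (p ^ (ν + eSha)))) hLG hG C hC hA₀ hdiv P hgen hord hSha hΓ htors hPQ
    hexact hCL hkill le_rfl (by omega)
  -- `#(p^t·C) = p^(m−t) = p^ν · p^(m−t−ν)`
  rw [natCard_map_nsmul_eq_pow_sub (by omega : ν + eSha ≤ m) hsC hs hCcard] at h99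
  have hsplit : p ^ (m - (ν + eSha)) = p ^ ν * p ^ (m - (ν + eSha) - ν) := by
    rw [← pow_add]; congr 1; omega
  rw [hsplit, mul_assoc, mul_comm (p ^ (m - (ν + eSha) - ν)) _, ← mul_assoc] at h99
  exact Nat.eq_of_mul_eq_mul_right (pow_pos hp.out.pos _) h99

end Summit.BirchSwinnertonDyer.Rank1Residual.Additive.LevelBridge

end
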